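import Summits.QuantumFields.BalabanUV.T4Continuum.Support.SubstrateAvgTowerFactorisation
import Summits.QuantumFields.BalabanUV.T4Continuum.Support.B13ReadingsAvgTowerUniform
import Summits.QuantumFields.BalabanUV.T4Continuum.Support.SubstrateLocalRateOn

/-!
# SUBSTRATE — W-25b = L-E19 (assembly): (ℓ1) FOR BAŁABAN's AVERAGING TOWERS, k-UNIFORM — `RegularTransporters P.L (unitMod P)
# (towerOf P ι (avgTower ℰ V)) (2α′ + 8κ) (2β′ + 16κ)` from the finest letters `(α′, β′)` and the DISPLAYED one-step correction letter `κ`, by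
# INSTANTIATING the NE5 owner's `FactorisationData` (g39-d `B13ReadingsAvgTowerUniform`) with the substrate's clauses at the datum (PART 3
# `SubstrateAvgTowerFactorisation`); the `hreg` binder of NE5's W1 chain at `RgV := towerOfS P ι (avgTower ℰ V)`; §2: (ℓ3) ON THE LEVEL WINDOW and the WINDOWED `hloc` (W-26 `LocalRateOn`)
# with (ℓ2)(ℓ4) displayed (typer (ο10)∕(π2)∕(π5-2)∕(π7); t4-dagwriter Q49∕Q50)

Cell `pub-balaban`, SUBSTRATE cell, seat `b2b-balaban-substrate-p3` (gen 4).  Summits-side under the LEAN PLACEMENT RULE.  Nothing re-derived: the induction is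
the owner's (`regularTransporters_of_factorisation`, thresholds `α′ ≤ 1∕16`, `κ ≤ 1∕64`, `2 ≤ L` as HE states them), the clauses are PART 3's, the junction is
`lprod_eq_list_prod` (his `lprod` = the ordered `List` product).

HONEST FRAMING: rung (B)+1 of the FINITE-VOLUME T⁴ programme — NOT infinite volume, NOT a mass gap, NOT Clay; spine PROVED 0∕9; NE5 ∕ NE2 NOT PRINTED ∕
NOT PROVED.  (ℓ1) holds GIVEN the displayed one-step letter `κ` (its discharge for `ℰ = expMeanLogSU` is the NE5 owner lineage's κ-programme, Q49 (a′)) and the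
finest letters (α′, β′) of the window — NO estimate is proved by the substrate; (ℓ3) is WINDOWED (F-TOP, PART 2 §5, W-26), (ℓ2)(ℓ4) stay displayed (NE2 ROOT-B).
HONEST DEPENDENCY (cell line, verbatim): continuum YM on T⁴ ⇐ BetaPertH ∧ nine spine estimates (0/9 proved); BetaPertH ⇐ (D1) ∧ (D4) ∧ CAP+tail;
G-an2-4 gates asym, D1 and NE2/3/4.  0 sorry; axioms ⊆ {propext, Classical.choice, Quot.sound}.
-/

noncomputable section

open scoped BigOperators Matrix Matrix.Norms.L2Operator

namespace Summit.QuantumFields.BalabanUV.T4Continuum.SubstrateAvgTowerRegularity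

open Literature.MathematicalPhysics.QuantumFieldTheory.Balaban1983to89
open Literature.MathematicalPhysics.QuantumFieldTheory.Balaban1983to89.B5Prop11Plancherel (Tor fine)
open Literature.MathematicalPhysics.QuantumFieldTheory.Balaban1983to89.B5G183RateUnitTower (lev lev_neZero)
open Literature.MathematicalPhysics.QuantumFieldTheory.Balaban1983to89.BlockAveraging (corr blockAvg)
open Summit.QuantumFields.BalabanUV.T4Continuum
open Summit.QuantumFields.BalabanUV.T4Continuum.BalabanAveragedTowerUnit (idx)
open Summit.QuantumFields.BalabanUV.T4Continuum.RegularBackgroundTower (RegularTransporters)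
open Summit.QuantumFields.BalabanUV.T4Continuum.NE2BalabanGauge (liftR)
open Summit.QuantumFields.BalabanUV.T4Continuum.SubstrateBackgroundTransporters (unitMod towerOf)
open Summit.QuantumFields.BalabanUV.T4Continuum.B13ReadingsLineProducts (lprod lprod_zero lprod_succ)
open Summit.QuantumFields.BalabanUV.T4Continuum.B13ReadingsAvgTowerDirect (bavg_consistent_of_corrLine)
open Summit.QuantumFields.BalabanUV.T4Continuum.B13ReadingsAvgTowerUniform (FactorisationData regularTransporters_of_factorisation regularTransporters_straight)
open Summit.QuantumFields.BalabanUV.T4Continuum.SubstrateLocalRateOn (LocalRateOn levelWindow localRateOn_regClass_of_bavg_consistentOn)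
open Summit.QuantumFields.BalabanUV.T4Continuum.BlockPairingGeometry (tau)
open Summit.QuantumFields.BalabanUV.T4Continuum.CovariantLinePlanting (bavg)
open Summit.QuantumFields.BalabanUV.T4Continuum.NE2FromNE3 (bgReadings)
open Summit.QuantumFields.BalabanUV.T4Continuum.RegularBackgroundTower (connTower dconnTower regClass)
open Literature.MathematicalPhysics.QuantumFieldTheory.Balaban1983to89.T4EtaRateMin (LocalRate)
open Summit.QuantumFields.BalabanUV.T4Continuum.SubstrateAvgTowerStructure (avgTower axialTower)
open Summit.QuantumFields.BalabanUV.T4Continuum.SubstrateAvgTowerPlumbing (towerOfS liftR_towerOfS)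
open Summit.QuantumFields.BalabanUV.T4Continuum.SubstrateAvgTowerFactorisation

/-- [folklore] the owner's `lprod` IS the ordered `List` product (junction). -/
theorem lprod_eq_list_prod {A : Type*} [NormedRing A] (f : ℕ → A) : ∀ n, lprod f n = ((List.range n).map f).prod
  | 0 => by rw [lprod_zero, List.range_zero, List.map_nil, List.prod_nil]
  | n + 1 => by rw [lprod_succ, lprod_eq_list_prod f n, List.range_succ, List.map_append, List.prod_append, List.map_singleton, List.prod_singleton]

variable (P : Params) {G : Type*} [GaugeGroup G] {o : Type*} [Fintype o] [DecidableEq o] (ι : G →* Matrix o o ℂ) (ℰ : LoopAverage G)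

/-- [folklore] **THE OWNER's `FactorisationData` INSTANTIATED AT THE AVERAGING TOWER OF RECORD**: `R := towerOf P ι (avgTower ℰ V)`, `S := towerOf P ι (axialTower V)`,
`st := stOf P`, `Cf := CfOf ι ℰ V`, finest level `Kf := P.K`, from the finest letters `hα′`∕`hβ′` and the DISPLAYED one-step letter `hκ`. -/
theorem factorisationData_avgTower (hdist : ∀ g, ‖ι g - 1‖ = dist1 g) (V : GaugeField P 0 G) {α' β' κ : ℝ} (hα0 : 0 ≤ α') (hβ0 : 0 ≤ β')
    (hα' : ∀ b : PBond P 0, (P.L : ℝ) ^ P.K * dist1 (V b) ≤ α')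
    (hβ' : ∀ (x : Site P 0) (ν μ : Fin P.d), (P.L : ℝ) ^ P.K * ‖ι (V ⟨x.shift μ, ν⟩) - ι (V ⟨x, ν⟩)‖ ≤ β' / (P.L : ℝ) ^ P.K)
    (hκ : ∀ (i k : ℕ), i + 1 + k = P.K → ∀ c : PBond P (i + 1), dist1 (corr ℰ (avgTower ℰ V i) c) * ((lev P.L k : ℕ) : ℝ) ^ 2 ≤ κ) :
    FactorisationData P.L (unitMod P) (towerOf P ι (avgTower ℰ V)) (towerOf P ι (axialTower V)) (stOf P) (CfOf ι ℰ V) P.K α' β' κ where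
  fin_eq k hk μ x := by rw [fin_eq_clause ι ℰ V hk]
  fin_size k hk μ x := fin_size_clause ι hdist V hα0 hα' hk μ x
  fin_lip k hk μ ν x := fin_lip_clause ι V hβ0 hβ' hk μ ν x
  start_shift k μ ν i := stOf_tau P k μ ν i
  straight k hk μ i := by rw [lprod_eq_list_prod]; exact straight_clause ι V hk μ i
  averaging k hk μ i := by rw [lprod_eq_list_prod]; exact averaging_clause ι ℰ V hk μ i
  corr k hk μ i := corr_clause ι ℰ hdist V hκ hk μ i

/-- [folklore] **(ℓ1) FOR THE AVERAGING TOWER, k-UNIFORM**: `RegularTransporters P.L (unitMod P) (towerOf P ι (avgTower ℰ V)) (2α′ + 8κ) (2β′ + 16κ)` — the owner's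
`regularTransporters_of_factorisation` at the datum (his thresholds `α′ ≤ 1∕16`, `κ ≤ 1∕64`, `2 ≤ L`). -/
theorem regularTransporters_avgTower (hdist : ∀ g, ‖ι g - 1‖ = dist1 g) (hL : 2 ≤ P.L) (V : GaugeField P 0 G) {α' β' κ : ℝ}
    (hα0 : 0 ≤ α') (hα : α' ≤ 1 / 16) (hβ0 : 0 ≤ β') (hκ0 : 0 ≤ κ) (hκ1 : κ ≤ 1 / 64)
    (hα' : ∀ b : PBond P 0, (P.L : ℝ) ^ P.K * dist1 (V b) ≤ α')
    (hβ' : ∀ (x : Site P 0) (ν μ : Fin P.d), (P.L : ℝ) ^ P.K * ‖ι (V ⟨x.shift μ, ν⟩) - ι (V ⟨x, ν⟩)‖ ≤ β' / (P.L : ℝ) ^ P.K)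
    (hκ : ∀ (i k : ℕ), i + 1 + k = P.K → ∀ c : PBond P (i + 1), dist1 (corr ℰ (avgTower ℰ V i) c) * ((lev P.L k : ℕ) : ℝ) ^ 2 ≤ κ) :
    RegularTransporters P.L (unitMod P) (towerOf P ι (avgTower ℰ V)) (2 * α' + 8 * κ) (2 * β' + 16 * κ) :=
  regularTransporters_of_factorisation P.L (unitMod P) (factorisationData_avgTower P ι ℰ hdist V hα0 hβ0 hα' hβ' hκ) hL hα0 hα hβ0 hκ0 hκ1

/-- [folklore] … and the AXIAL tower is `RegularTransporters … (2α′) (2β′)` (no κ). -/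
theorem regularTransporters_axialTower (hdist : ∀ g, ‖ι g - 1‖ = dist1 g) (hL : 2 ≤ P.L) (V : GaugeField P 0 G) {α' β' κ : ℝ}
    (hα0 : 0 ≤ α') (hα : α' ≤ 1 / 8) (hβ0 : 0 ≤ β')
    (hα' : ∀ b : PBond P 0, (P.L : ℝ) ^ P.K * dist1 (V b) ≤ α')
    (hβ' : ∀ (x : Site P 0) (ν μ : Fin P.d), (P.L : ℝ) ^ P.K * ‖ι (V ⟨x.shift μ, ν⟩) - ι (V ⟨x, ν⟩)‖ ≤ β' / (P.L : ℝ) ^ P.K)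
    (hκ : ∀ (i k : ℕ), i + 1 + k = P.K → ∀ c : PBond P (i + 1), dist1 (corr ℰ (avgTower ℰ V i) c) * ((lev P.L k : ℕ) : ℝ) ^ 2 ≤ κ) :
    RegularTransporters P.L (unitMod P) (towerOf P ι (axialTower V)) (2 * α') (2 * β') :=
  regularTransporters_straight P.L (unitMod P) (factorisationData_avgTower P ι ℰ hdist V hα0 hβ0 hα' hβ' hκ) hL hα0 hα hβ0

/-- [folklore] **THE `hreg` BINDER OF NE5's W1 CHAIN AT THE AVERAGING TOWERS** (`RgV b := towerOfS P ι (avgTower ℰ (fld b))`, PART 2 `liftR_towerOfS`): for every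
finest configuration of a window whose members carry the finest letters `(α′, β′)` and the one-step letter `κ`, UNIFORMLY. -/
theorem hreg_avgTower (hdist : ∀ g, ‖ι g - 1‖ = dist1 g) (hL : 2 ≤ P.L) {BgD : Type*} {dom : Set BgD} (fld : BgD → GaugeField P 0 G) {α' β' κ : ℝ}
    (hα0 : 0 ≤ α') (hα : α' ≤ 1 / 16) (hβ0 : 0 ≤ β') (hκ0 : 0 ≤ κ) (hκ1 : κ ≤ 1 / 64)
    (hα' : ∀ b ∈ dom, ∀ c : PBond P 0, (P.L : ℝ) ^ P.K * dist1 (fld b c) ≤ α')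
    (hβ' : ∀ b ∈ dom, ∀ (x : Site P 0) (ν μ : Fin P.d), (P.L : ℝ) ^ P.K * ‖ι (fld b ⟨x.shift μ, ν⟩) - ι (fld b ⟨x, ν⟩)‖ ≤ β' / (P.L : ℝ) ^ P.K)
    (hκ : ∀ b ∈ dom, ∀ (i k : ℕ), i + 1 + k = P.K → ∀ c : PBond P (i + 1), dist1 (corr ℰ (avgTower ℰ (fld b) i) c) * ((lev P.L k : ℕ) : ℝ) ^ 2 ≤ κ) :
    ∀ b ∈ dom, RegularTransporters P.L (unitMod P) (liftR P.L (unitMod P) (towerOfS P ι (avgTower ℰ (fld b)))) (2 * α' + 8 * κ) (2 * β' + 16 * κ) :=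
  fun b hb => by
    rw [liftR_towerOfS]
    exact regularTransporters_avgTower P ι ℰ hdist hL (fld b) hα0 hα hβ0 hκ0 hκ1 (hα' b hb) (hβ' b hb) (hκ b hb)

/-! ## §2 (ℓ3) ON THE LEVEL WINDOW, and the WINDOWED `hloc` (F-TOP disposition (R1); typer (π5-2)) -/

/-- [folklore] **(ℓ3) FOR THE AVERAGING TOWER ON THE LEVEL WINDOW `k + 1 ≤ K`**: block-average consistency of the connection tower with
`γ₃ := κ·e^{α} + α² + (2d+1)·β`, `(α, β) := (2α′ + 8κ, 2β′ + 16κ)` — the NE5 owner's ONE-STEP `bavg_consistent_of_corrLine` at each physical pair of levels, fed by PART 3's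
`averaging_clause` ∕ `corr_clause` and §1's (ℓ1) (`α ≤ 1` from the thresholds).  The top pair `(K, K+1)` is EXCLUDED (F-TOP: there the letter is false at padded towers). -/
theorem hbavg_avgTower_on_levelWindow (hdist : ∀ g, ‖ι g - 1‖ = dist1 g) (hL : 2 ≤ P.L) (V : GaugeField P 0 G) {α' β' κ : ℝ}
    (hα0 : 0 ≤ α') (hα : α' ≤ 1 / 16) (hβ0 : 0 ≤ β') (hκ0 : 0 ≤ κ) (hκ1 : κ ≤ 1 / 64)
    (hα' : ∀ b : PBond P 0, (P.L : ℝ) ^ P.K * dist1 (V b) ≤ α')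
    (hβ' : ∀ (x : Site P 0) (ν μ : Fin P.d), (P.L : ℝ) ^ P.K * ‖ι (V ⟨x.shift μ, ν⟩) - ι (V ⟨x, ν⟩)‖ ≤ β' / (P.L : ℝ) ^ P.K)
    (hκ : ∀ (i k : ℕ), i + 1 + k = P.K → ∀ c : PBond P (i + 1), dist1 (corr ℰ (avgTower ℰ V i) c) * ((lev P.L k : ℕ) : ℝ) ^ 2 ≤ κ) :
    ∀ k ∈ levelWindow P.K, ∀ (μ : Fin P.d) (y : idx P.L (unitMod P) k),
      ‖bavg (lev P.L k) P.L (unitMod P) (connTower P.L (unitMod P) (towerOf P ι (avgTower ℰ V)) (k + 1) μ) y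
          - connTower P.L (unitMod P) (towerOf P ι (avgTower ℰ V)) k μ y‖
        ≤ (κ * Real.exp (2 * α' + 8 * κ) + (2 * α' + 8 * κ) ^ 2 + (2 * P.d + 1) * (2 * β' + 16 * κ)) / (lev P.L k : ℕ) := by
  intro k hk μ y
  have hk' : k < P.K := by simp only [levelWindow, Set.mem_setOf_eq] at hk; omega
  have hreg := regularTransporters_avgTower P ι ℰ hdist hL V hα0 hα hβ0 hκ0 hκ1 hα' hβ' hκ
  have hα1 : 2 * α' + 8 * κ ≤ 1 := by linarith
  have hstruct := averaging_clause ι ℰ V hk' μ y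
  rw [← lprod_eq_list_prod] at hstruct
  exact bavg_consistent_of_corrLine P.L (unitMod P) hreg hα1 hstruct (corr_clause ι ℰ hdist V hκ hk' μ y)

/-- [folklore] **THE WINDOWED `hloc` AT THE AVERAGING TOWER** (W-26's `localRateOn_regClass_of_bavg_consistentOn` at `S := levelWindow K`): with (ℓ1)(ℓ3) PROVED above and
the second-order letters (ℓ2) `hlipD` (every level) ∕ (ℓ4) `hbavgD` (on the window) DISPLAYED (row NE2 ROOT-B per Q49 (b)),
`LocalRateOn (levelWindow K) (bgReadings (regClass (towerOf P ι (avgTower ℰ V)))) (γ₃ ⊔ γD + 2d·max β βD) L⁻¹`.  The UN-windowed `hloc` is unreachable here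
(PART 2 §5 `finest_small_of_hloc`). -/
theorem hloc_avgTower_on_levelWindow (hdist : ∀ g, ‖ι g - 1‖ = dist1 g) (hL : 2 ≤ P.L) (V : GaugeField P 0 G) {α' β' κ βD γD : ℝ}
    (hα0 : 0 ≤ α') (hα : α' ≤ 1 / 16) (hβ0 : 0 ≤ β') (hκ0 : 0 ≤ κ) (hκ1 : κ ≤ 1 / 64) (hβD : 0 ≤ βD)
    (hα' : ∀ b : PBond P 0, (P.L : ℝ) ^ P.K * dist1 (V b) ≤ α')
    (hβ' : ∀ (x : Site P 0) (ν μ : Fin P.d), (P.L : ℝ) ^ P.K * ‖ι (V ⟨x.shift μ, ν⟩) - ι (V ⟨x, ν⟩)‖ ≤ β' / (P.L : ℝ) ^ P.K)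
    (hκ : ∀ (i k : ℕ), i + 1 + k = P.K → ∀ c : PBond P (i + 1), dist1 (corr ℰ (avgTower ℰ V i) c) * ((lev P.L k : ℕ) : ℝ) ^ 2 ≤ κ)
    (hlipD : ∀ k μ ν (i : idx P.L (unitMod P) k),
      ‖dconnTower P.L (unitMod P) (towerOf P ι (avgTower ℰ V)) k μ (tau (fine (lev P.L k) (unitMod P)) ν i)
        - dconnTower P.L (unitMod P) (towerOf P ι (avgTower ℰ V)) k μ i‖ ≤ βD / (lev P.L k : ℕ))
    (hbavgD : ∀ k ∈ levelWindow P.K, ∀ μ (y : idx P.L (unitMod P) k),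
      ‖bavg (lev P.L k) P.L (unitMod P) (dconnTower P.L (unitMod P) (towerOf P ι (avgTower ℰ V)) (k + 1) μ) y
        - dconnTower P.L (unitMod P) (towerOf P ι (avgTower ℰ V)) k μ y‖ ≤ γD / (lev P.L k : ℕ)) :
    LocalRateOn (levelWindow P.K) (bgReadings P.L (unitMod P) (regClass P.L (unitMod P) (towerOf P ι (avgTower ℰ V))))
      (max (κ * Real.exp (2 * α' + 8 * κ) + (2 * α' + 8 * κ) ^ 2 + (2 * P.d + 1) * (2 * β' + 16 * κ)) γD + 2 * P.d * max (2 * β' + 16 * κ) βD)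
      ((P.L : ℝ)⁻¹) := by
  refine localRateOn_regClass_of_bavg_consistentOn P.L (unitMod P) (regularTransporters_avgTower P ι ℰ hdist hL V hα0 hα hβ0 hκ0 hκ1 hα' hβ' hκ) hβD
    hlipD (fun k hk μ y => ?_) (fun k hk μ y => ?_)
  · exact (hbavg_avgTower_on_levelWindow P ι ℰ hdist hL V hα0 hα hβ0 hκ0 hκ1 hα' hβ' hκ k hk μ y).trans
      (div_le_div_of_nonneg_right (le_max_left _ _) (Nat.cast_nonneg _))
  · exact (hbavgD k hk μ y).trans (div_le_div_of_nonneg_right (le_max_right _ _) (Nat.cast_nonneg _))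

/-- [folklore] **THE WINDOWED `hloc` IN BINDER SHAPE** (`∀ b ∈ dom`, at `RgV b := towerOfS P ι (avgTower ℰ (fld b))`, the shape a windowed owner twin g38-c′ would
display per typer (π5-4)): window-uniform letters in, `LocalRateOn (levelWindow K) (bgReadings (regClass (liftR (RgV b)))) C L⁻¹` out for every `b ∈ dom`. -/
theorem hloc_avgTower_on_levelWindow_dom (hdist : ∀ g, ‖ι g - 1‖ = dist1 g) (hL : 2 ≤ P.L) {BgD : Type*} {dom : Set BgD} (fld : BgD → GaugeField P 0 G)
    {α' β' κ βD γD : ℝ} (hα0 : 0 ≤ α') (hα : α' ≤ 1 / 16) (hβ0 : 0 ≤ β') (hκ0 : 0 ≤ κ) (hκ1 : κ ≤ 1 / 64) (hβD : 0 ≤ βD)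
    (hα' : ∀ b ∈ dom, ∀ c : PBond P 0, (P.L : ℝ) ^ P.K * dist1 (fld b c) ≤ α')
    (hβ' : ∀ b ∈ dom, ∀ (x : Site P 0) (ν μ : Fin P.d), (P.L : ℝ) ^ P.K * ‖ι (fld b ⟨x.shift μ, ν⟩) - ι (fld b ⟨x, ν⟩)‖ ≤ β' / (P.L : ℝ) ^ P.K)
    (hκ : ∀ b ∈ dom, ∀ (i k : ℕ), i + 1 + k = P.K → ∀ c : PBond P (i + 1), dist1 (corr ℰ (avgTower ℰ (fld b) i) c) * ((lev P.L k : ℕ) : ℝ) ^ 2 ≤ κ)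
    (hlipD : ∀ b ∈ dom, ∀ k μ ν (i : idx P.L (unitMod P) k),
      ‖dconnTower P.L (unitMod P) (towerOf P ι (avgTower ℰ (fld b))) k μ (tau (fine (lev P.L k) (unitMod P)) ν i)
        - dconnTower P.L (unitMod P) (towerOf P ι (avgTower ℰ (fld b))) k μ i‖ ≤ βD / (lev P.L k : ℕ))
    (hbavgD : ∀ b ∈ dom, ∀ k ∈ levelWindow P.K, ∀ μ (y : idx P.L (unitMod P) k),
      ‖bavg (lev P.L k) P.L (unitMod P) (dconnTower P.L (unitMod P) (towerOf P ι (avgTower ℰ (fld b))) (k + 1) μ) y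
        - dconnTower P.L (unitMod P) (towerOf P ι (avgTower ℰ (fld b))) k μ y‖ ≤ γD / (lev P.L k : ℕ)) :
    ∀ b ∈ dom, LocalRateOn (levelWindow P.K)
      (bgReadings P.L (unitMod P) (regClass P.L (unitMod P) (liftR P.L (unitMod P) (towerOfS P ι (avgTower ℰ (fld b))))))
      (max (κ * Real.exp (2 * α' + 8 * κ) + (2 * α' + 8 * κ) ^ 2 + (2 * P.d + 1) * (2 * β' + 16 * κ)) γD + 2 * P.d * max (2 * β' + 16 * κ) βD)
      ((P.L : ℝ)⁻¹) := fun b hb => by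
  rw [liftR_towerOfS]
  exact hloc_avgTower_on_levelWindow P ι ℰ hdist hL (fld b) hα0 hα hβ0 hκ0 hκ1 hβD (hα' b hb) (hβ' b hb) (hκ b hb) (hlipD b hb) (hbavgD b hb)

end Summit.QuantumFields.BalabanUV.T4Continuum.SubstrateAvgTowerRegularity

end
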